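import Literature.Analysis.FluidPDE.LerayEnstrophyAPriori
import Literature.Analysis.FluidPDE.PineauVicolEnstrophy
import HarnessLib

/-!
# Leray's small energy–enstrophy monotonicity: the combined enstrophy inequality with
# dissipation, `(∫|∇u|²)² ≤ ∫|u|² ∫|Δu|²`, and `t ↦ ∫|∇u(t)|²` non-increasing while
# `‖u‖₂² ‖∇u‖₂² ≲ ν⁴` (Leray 1934 §§20, 34; Robinson–Rodrigo–Sadowski 2016, Lemma 6.13, Thm. 8.1)

Analysis/FluidPDE **proofs file** (theorems only: no definitions, no named facts, no `sorry`),
continuation of `Literature/Analysis/FluidPDE/LerayEnstrophyAPriori.lean`.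

For a classical solution `(u, p)` of the unforced Navier–Stokes system on a closed slab
`[0, T] × ℝ³` in the smooth `H¹` class of Tao's theory (`u, ∂ₜu, p ∈ L^∞_t H^k_x` for all `k`, the
class produced away from the initial time by Leray's regular solutions from `H¹` data,
`leray_local_regular_H1_holds`), write `G(t) = ∫ |∇u(t)|²` and `D(t) = ∫ ‖Δu(t)‖²`. We prove:

* `exists_enstrophy_dissipative_ineq` — the cubic enstrophy inequality **keeping the
  dissipation** (Robinson–Rodrigo–Sadowski 2016, (6.7) integrated; `LerayEnstrophyAPriori.lean`
  proves the same slab inequality but records the two halves `G(b) ≤ G(0) + κν⁻³∫₀ᵇG³` and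
  `ν∫₀ᵀ D ≤ G(0) + κν⁻³∫₀ᵀ G³` separately, which loses the decay mechanism):
  `ν ∫₀ᵇ D ≤ G(0) − G(b) + κ ν⁻³ ∫₀ᵇ G³` for every `b ∈ [0, T]` (lower integral in time);
* `sq_integral_frobeniusNormSq_fderiv_le` — the interpolation `(∫|∇v|²)² ≤ (∫‖v‖²)(∫‖Δv‖²)`
  for a smooth field with `v, Dv, D²v ∈ L²` (Green's identity `∫|∇v|² = −∫⟪v, Δv⟫`, tree
  `PineauVicol2026.integral_inner_laplacian_self_eq_neg`, and Cauchy–Schwarz);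
* `le_initial_of_integral_ineq` — the real-variable continuity method: if `G` is continuous,
  `G(b) ≤ G(0) + ∫₀ᵇ φ(G)` with `φ ≤ 0` on `[0, θ]` and `G(0) < θ`, then `G(t) ≤ G(0)` throughout;
* `exists_enstrophy_le_initial_of_small` — **Leray's monotonicity**: there is an absolute
  `c₀ > 0` such that if `∫‖u(t)‖² ≤ E₀` on `[0, T]` and `E₀ · G(0) < c₀ ν⁴`, then `G(t) ≤ G(0)` for all
  `t ∈ [0, T]`. Indeed `νD ≥ νG²/E₀`, so `G(b) ≤ G(0) + ∫₀ᵇ G²(κν⁻³G − ν/E₀) ≤ G(0)` as long as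
  `κE₀G ≤ ν⁴`, which the continuity method propagates (`c₀ = 1/κ`). This is the differential
  inequality behind Leray's "if `ν⁻³ W(0) J²(0)` [energy × enstrophy] is small the regular solution
  never ceases to exist" (Leray 1934, §20, (3.13)–(3.14) and §34) in the form printed by
  Robinson–Rodrigo–Sadowski 2016, Lemma 6.13 ("`‖u₀‖‖∇u₀‖ ≤ c` ⇒ global", via
  `d/dt‖∇u‖² ≤ ‖∇u‖⁴(c‖∇u‖²‖u‖² − 1)/‖u‖²`-type bookkeeping) and used for Thm. 8.1 (eventual
  regularity of global Leray–Hopf solutions). The scale-invariant smallness is on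
  `‖u‖²_{L²} ‖∇u‖²_{L²} / ν⁴`.

The energy bound `∫‖u(t)‖² ≤ E₀` is taken as a hypothesis (for Leray–Hopf solutions it is the
energy inequality; no classical energy identity is re-derived here).

## Mathlib / tree search

Reused: the slice production bound `exists_slice_dissipative`, the class bookkeeping of
`exists_enstrophy_cubic_ineq` (`LerayEnstrophyAPriori.lean`, whose proof is re-run here with the
combined conclusion), `IsSmoothSpaceTimeOn.enstrophy_balance` (`SerrinEnstrophyGronwall.lean`),
`eLpNorm_six_le_eLpNorm_fderiv_two`, `linfty_bound_of_hasBoundedSobolevNormsOn_holds`,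
`PineauVicol2026.integral_inner_laplacian_self_eq_neg` (Green), `integrable_of_norm_le_mul_of_lintegral_sq`.
`lean search 'enstrophy_le_initial' / 'eventual' / 'Lemma 6.13'`: the torus twin
`Torus.exists_global_classicalNS_of_small_energy_enstrophy` (`TorusNSSmallDataGlobal.lean`) exists;
nothing on `ℝ³`.

## References

* J. Leray, *Sur le mouvement d'un liquide visqueux emplissant l'espace*, Acta Math. 63 (1934)
  193–248, §20 ((3.13)–(3.14)) and §34. [Leray1934]
* J. C. Robinson, J. L. Rodrigo, W. Sadowski, *The Three-Dimensional Navier–Stokes Equations*,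
  CUP 2016, (6.6)–(6.10), Lemma 6.13 (p. 109), Thm. 8.1 (p. 122). [RobinsonRodrigoSadowski2016]

WHAT THIS IS NOT: not a claim about NS regularity or blow-up; not a claim about any author beyond
the typed locator.
-/

noncomputable section

open MeasureTheory Set Function Filter Topology InnerProductSpace
open scoped ENNReal NNReal ContDiff RealInnerProductSpace Laplacian

namespace Literature.Analysis.FluidPDE

/-! ### The real-variable continuity method -/

/-- **Continuity method, monotone form.** Let `G` be continuous on `[0, T]` with
`G(b) ≤ G(0) + ∫₀ᵇ φ(G(t)) dt` for every `b ∈ [0, T]`, where `φ` is continuous and `φ(g) ≤ 0` for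
`0 ≤ g ≤ θ`, `G ≥ 0` on `[0, T]` and `G(0) < θ`. Then `G(t) ≤ G(0)` for every `t ∈ [0, T]`
(real induction: the set of `b` with `G ≤ G(0)` on `[0, b]` is closed, and from any such `b < T`
the bound `G < θ` persists a little, making the integrand non-positive). [folklore] -/
private theorem le_initial_of_integral_ineq {T θ : ℝ} (hT : 0 ≤ T) {G φ : ℝ → ℝ}
    (hGc : ContinuousOn G (Icc 0 T)) (hφc : Continuous φ)
    (hφ : ∀ g, 0 ≤ g → g ≤ θ → φ g ≤ 0) (hG0 : ∀ t ∈ Icc 0 T, 0 ≤ G t) (hθ : G 0 < θ)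
    (hineq : ∀ b ∈ Icc 0 T, G b ≤ G 0 + ∫ t in (0 : ℝ)..b, φ (G t)) :
    ∀ t ∈ Icc 0 T, G t ≤ G 0 := by
  -- the set of times `b` such that `G ≤ G 0` on `[0, b]`, written with `min` to make it closed
  set s : Set ℝ := {b | ∀ t ∈ Icc 0 T, G (min t b) ≤ G 0} with hs
  have hmin_cont : ∀ t ∈ Icc 0 T, ContinuousOn (fun b => G (min t b)) (Icc 0 T) := by
    intro t ht
    refine hGc.comp ((continuous_const.min continuous_id).continuousOn) fun b hb => ?_
    exact ⟨le_min ht.1 hb.1, (min_le_right _ _).trans hb.2⟩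
  have hsc : IsClosed (s ∩ Icc 0 T) := by
    have : s ∩ Icc 0 T = ⋂ t ∈ Icc 0 T, {b ∈ Icc 0 T | G (min t b) ≤ G 0} := by
      ext b
      simp only [hs, mem_inter_iff, mem_setOf_eq, mem_iInter]
      constructor
      · rintro ⟨h1, h2⟩ t ht
        exact ⟨h2, h1 t ht⟩
      · intro h
        have hT' : T ∈ Icc 0 T := ⟨hT, le_rfl⟩
        exact ⟨fun t ht => (h t ht).2, (h T hT').1⟩
    rw [this]
    refine isClosed_biInter fun t ht => ?_
    exact (hmin_cont t ht).preimage_isClosed_of_isClosed isClosed_Icc isClosed_Iic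
  have h0s : (0 : ℝ) ∈ s := by
    intro t ht
    rw [min_eq_right ht.1]
  -- from `b ∈ s`, `b < T`: `G < θ` on a right neighbourhood, hence the bound persists
  have hstep : ∀ b ∈ s ∩ Ico 0 T, s ∈ 𝓝[>] b := by
    rintro b ⟨hb, hb0, hbT⟩
    have hbI : b ∈ Icc 0 T := ⟨hb0, hbT.le⟩
    -- `G b ≤ G 0 < θ`
    have hGb : G b ≤ G 0 := by simpa [min_self] using hb b hbI
    -- continuity of `G` within `[0, T]` at `b`: `G < θ` on `[b, b + δ] ∩ [0, T]`
    have hcont : ContinuousWithinAt G (Icc 0 T) b := hGc b hbI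
    have hlt : ∀ᶠ t in 𝓝[Icc 0 T] b, G t < θ :=
      hcont.eventually (p := fun y => y < θ) (isOpen_Iio.mem_nhds (hGb.trans_lt hθ))
    obtain ⟨δ, hδ, hδlt⟩ : ∃ δ > 0, ∀ t ∈ Icc 0 T, dist t b < δ → G t < θ := by
      rcases Metric.mem_nhdsWithin_iff.1 hlt with ⟨δ, hδ, h⟩
      exact ⟨δ, hδ, fun t ht hd => h ⟨hd, ht⟩⟩
    set δ' : ℝ := min (δ / 2) (T - b) with hδ'
    have hδ'pos : 0 < δ' := lt_min (half_pos hδ) (sub_pos.2 hbT)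
    have hsub : Icc b (b + δ') ⊆ s := by
      intro b' hb' t ht
      -- on `[0, b']`: either `≤ b` (use `hb`) or in `(b, b']` (integrand non-positive)
      have hb'T : b' ≤ T := by
        have : δ' ≤ T - b := min_le_right _ _
        linarith [hb'.2]
      have hb'I : b' ∈ Icc 0 T := ⟨hb0.trans hb'.1, hb'T⟩
      -- `G ≤ θ` on `[0, b']`
      have hGθ : ∀ τ ∈ Icc 0 b', G τ ≤ θ := by
        intro τ hτ
        rcases le_or_gt τ b with hτb | hτb
        · have h := hb τ ⟨hτ.1, hτ.2.trans hb'T⟩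
          rw [min_eq_left hτb] at h
          exact h.trans hθ.le
        · refine (hδlt τ ⟨hτ.1, hτ.2.trans hb'T⟩ ?_).le
          rw [Real.dist_eq, abs_of_pos (sub_pos.2 hτb)]
          have : δ' ≤ δ / 2 := min_le_left _ _
          linarith [hτ.2, hb'.2]
      -- hence `G b'' ≤ G 0` for every `b'' ∈ [0, b']`
      have hle : ∀ b'' ∈ Icc 0 b', G b'' ≤ G 0 := by
        intro b'' hb''
        have hb''I : b'' ∈ Icc 0 T := ⟨hb''.1, hb''.2.trans hb'T⟩
        have hint : ∫ τ in (0 : ℝ)..b'', φ (G τ) ≤ 0 := by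
          have h : ∫ τ in (0 : ℝ)..b'', φ (G τ) ≤ ∫ τ in (0 : ℝ)..b'', (0 : ℝ) := by
            refine intervalIntegral.integral_mono_on hb''.1 ?_ ?_ fun τ hτ => ?_
            · exact ((hφc.comp_continuousOn (hGc.mono (Icc_subset_Icc le_rfl hb''I.2)))
                ).intervalIntegrable_of_Icc hb''.1
            · exact intervalIntegrable_const
            · exact hφ _ (hG0 τ ⟨hτ.1, hτ.2.trans hb''I.2⟩) (hGθ τ ⟨hτ.1, hτ.2.trans hb''.2⟩)
          simpa using h
        linarith [hineq b'' hb''I]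
      rcases le_total t b' with htb | htb
      · rw [min_eq_left htb]; exact hle t ⟨ht.1, htb⟩
      · rw [min_eq_right htb]; exact hle b' ⟨hb'I.1, le_rfl⟩
    exact mem_of_superset (Icc_mem_nhdsGT (by linarith)) hsub
  intro t ht
  have hmem : t ∈ s :=
    (hsc.Icc_subset_of_forall_mem_nhdsWithin h0s (fun b hb => hstep b ⟨hb.1, hb.2⟩)) ht
  simpa [min_self] using hmem t ht

/-! ### Interpolation `(∫|∇v|²)² ≤ ∫‖v‖² · ∫‖Δv‖²` -/

/-- **`‖∇v‖⁴_{L²} ≤ ‖v‖²_{L²} ‖Δv‖²_{L²}`** for a `C²` field `v : ℝ³ → ℝ³` with `v, Dv, Δv ∈ L²`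
(`Δv` continuous): by Green's identity `∫ |∇v|² = −∫ ⟪v, Δv⟫`
(`PineauVicol2026.integral_inner_laplacian_self_eq_neg`) the quadratic
`s ↦ ∫ ‖s v + Δv‖² = s² ∫‖v‖² − 2s ∫|∇v|² + ∫‖Δv‖²` is non-negative, so its discriminant is
non-positive (Robinson–Rodrigo–Sadowski 2016, proof of Lemma 6.13: `‖∇u‖² ≤ ‖u‖‖Δu‖`). [cite: RobinsonRodrigoSadowski2016, Lemma 6.13 (proof)] -/
theorem sq_integral_frobeniusNormSq_fderiv_le
    {v : EuclideanSpace ℝ (Fin 3) → EuclideanSpace ℝ (Fin 3)} (hv : ContDiff ℝ 2 v)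
    (hΔc : Continuous (Δ v)) (h0 : ∫⁻ x, ‖v x‖ₑ ^ 2 < ⊤) (h1 : ∫⁻ x, ‖fderiv ℝ v x‖ₑ ^ 2 < ⊤)
    (h2 : ∫⁻ x, ‖(Δ v) x‖ₑ ^ 2 < ⊤) :
    (∫ x, frobeniusNormSq (fderiv ℝ v x)) ^ 2 ≤ (∫ x, ‖v x‖ ^ 2) * ∫ x, ‖(Δ v) x‖ ^ 2 := by
  have hvc : Continuous v := hv.continuous
  have hDc : Continuous (fderiv ℝ v) := hv.continuous_fderiv two_ne_zero
  have iv : Integrable (fun x => ‖v x‖ ^ 2) volume := integrable_sq_norm_of_lintegral_lt_top hvc h0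
  have iD : Integrable (fun x => ‖fderiv ℝ v x‖ ^ 2) volume :=
    integrable_sq_norm_of_lintegral_lt_top hDc h1
  have iΔ : Integrable (fun x => ‖(Δ v) x‖ ^ 2) volume := integrable_sq_norm_of_lintegral_lt_top hΔc h2
  have ivD : Integrable (fun x => ‖v x‖ * ‖fderiv ℝ v x‖) volume :=
    integrable_of_norm_le_mul_of_lintegral_sq ((hvc.norm.mul hDc.norm).aestronglyMeasurable)
      hvc hDc h0 h1 fun x => by
        rw [Real.norm_of_nonneg (mul_nonneg (norm_nonneg _) (norm_nonneg _))]
  have iΔv : Integrable (fun x => ‖(Δ v) x‖ * ‖v x‖) volume :=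
    integrable_of_norm_le_mul_of_lintegral_sq ((hΔc.norm.mul hvc.norm).aestronglyMeasurable)
      hΔc hvc h2 h0 fun x => by
        rw [Real.norm_of_nonneg (mul_nonneg (norm_nonneg _) (norm_nonneg _))]
  have iinner : Integrable (fun x => ⟪v x, (Δ v) x⟫) volume :=
    integrable_of_norm_le_mul_of_lintegral_sq ((hvc.inner hΔc).aestronglyMeasurable)
      hvc hΔc h0 h2 fun x => norm_inner_le_norm _ _
  -- Green's identity
  obtain ⟨-, hgreen⟩ := PineauVicol2026.integral_inner_laplacian_self_eq_neg hv ivD iD iΔv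
  set A : ℝ := ∫ x, ‖v x‖ ^ 2 with hA
  set B : ℝ := ∫ x, ‖(Δ v) x‖ ^ 2 with hB
  set X : ℝ := ∫ x, frobeniusNormSq (fderiv ℝ v x) with hX
  set P : ℝ := ∫ x, ⟪v x, (Δ v) x⟫ with hP
  have hPX : P = -X := by
    rw [hP, hX, ← hgreen]
    exact integral_congr_ae (Eventually.of_forall fun x => real_inner_comm _ _)
  -- the non-negative quadratic `s ↦ ∫ ‖s • v + Δ v‖² = A s² + 2 P s + B`
  have hquad : ∀ s : ℝ, 0 ≤ A * (s * s) + 2 * P * s + B := by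
    intro s
    have hpt : ∀ x, ‖s • v x + (Δ v) x‖ ^ 2 = s * s * ‖v x‖ ^ 2 + 2 * s * ⟪v x, (Δ v) x⟫ +
        ‖(Δ v) x‖ ^ 2 := by
      intro x
      rw [norm_add_sq_real, norm_smul, mul_pow, real_inner_smul_left, Real.norm_eq_abs, sq_abs]
      ring
    have hint : ∫ x, ‖s • v x + (Δ v) x‖ ^ 2 = A * (s * s) + 2 * P * s + B := by
      simp_rw [hpt]
      have e1 : ∫ x, s * s * ‖v x‖ ^ 2 + 2 * s * ⟪v x, (Δ v) x⟫ + ‖(Δ v) x‖ ^ 2 =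
          (∫ x, s * s * ‖v x‖ ^ 2 + 2 * s * ⟪v x, (Δ v) x⟫) + ∫ x, ‖(Δ v) x‖ ^ 2 :=
        integral_add ((iv.const_mul _).add (iinner.const_mul _)) iΔ
      have e2 : ∫ x, s * s * ‖v x‖ ^ 2 + 2 * s * ⟪v x, (Δ v) x⟫ =
          (∫ x, s * s * ‖v x‖ ^ 2) + ∫ x, 2 * s * ⟪v x, (Δ v) x⟫ :=
        integral_add (iv.const_mul _) (iinner.const_mul _)
      rw [e1, e2, integral_const_mul, integral_const_mul]
      rw [hA, hP, hB]; ring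
    rw [← hint]
    exact integral_nonneg fun x => sq_nonneg _
  have hdisc := discrim_le_zero hquad
  rw [discrim] at hdisc
  rw [show X ^ 2 = P ^ 2 by rw [hPX]; ring]
  nlinarith [hdisc]

/-! ### The cubic enstrophy inequality keeping the dissipation -/

section Slab
set_option maxHeartbeats 400000 in -- buildfix (bf3-g26): 160k/180k FAIL, 200k PASS at accept time; line-neutral budget line
/-- **The enstrophy inequality with dissipation, combined form** (Robinson–Rodrigo–Sadowski 2016,
(6.7) `d/dt ‖∇u‖² + ν‖Δu‖² ≤ c ν⁻³ ‖∇u‖⁶`, integrated on `[0, b]`). There is an absolute `κ > 0`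
such that for every classical solution `(u, p)` of the unforced Navier–Stokes system on a closed
slab `[0, T] × ℝ³` in the smooth `H¹` class (`u, ∂ₜu, p ∈ L^∞_t H^k_x`), with
`G(t) = ∫ |∇u(t)|²`: `G` is continuous on `[0, T]`; for every `b ∈ [0, T]`,
`G(b) ≤ G(0) + κν⁻³∫₀ᵇ G³` and
`ν ∫₀ᵇ ∫ ‖Δu‖² ≤ G(0) − G(b) + κ ν⁻³ ∫₀ᵇ G³` (lower integral in time on the left); every slice
satisfies `G(t)² ≤ (∫‖u(t)‖²)(∫‖Δu(t)‖²)` with `∫⁻ ‖Δu(t)‖ₑ² = ofReal ∫‖Δu(t)‖²`; and `G(t)` is the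
lower integral `∫⁻ |∇u(t)|²`. Same proof as `exists_enstrophy_cubic_ineq` (enstrophy balance
`IsSmoothSpaceTimeOn.enstrophy_balance`, slice bound `exists_slice_dissipative`, Sobolev
`‖u‖_{L⁶} ≤ K‖Du‖_{L²}`), keeping `−νD` in the bookkeeping. [cite: RobinsonRodrigoSadowski2016, Thm. 6.8 (proof, (6.7))] -/
theorem exists_enstrophy_dissipative_ineq :
    ∃ κ : ℝ, 0 < κ ∧ ∀ ⦃ν T : ℝ⦄ (_ : 0 < ν) (_ : 0 < T)
      ⦃u : ℝ → EuclideanSpace ℝ (Fin 3) → EuclideanSpace ℝ (Fin 3)⦄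
      ⦃p : ℝ → EuclideanSpace ℝ (Fin 3) → ℝ⦄
      (_ : FluidPDE.IsClassicalNSSolutionOn (Icc 0 T) ν 0 u p)
      (_ : HasBoundedSobolevNormsOn (Icc 0 T) u)
      (_ : HasBoundedSobolevNormsOn (Icc 0 T) (FluidPDE.timeDerivWithin (Icc 0 T) u))
      (_ : ∀ n : ℕ, ∃ C : ℝ≥0, ∀ t ∈ Icc 0 T, ∫⁻ x, ‖iteratedFDeriv ℝ n (p t) x‖ₑ ^ 2 ≤ C),
      ContinuousOn (fun t => ∫ x, FluidPDE.frobeniusNormSq (fderiv ℝ (u t) x)) (Icc 0 T) ∧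
      (∀ b ∈ Icc 0 T, ∫ x, FluidPDE.frobeniusNormSq (fderiv ℝ (u b) x) ≤
        (∫ x, FluidPDE.frobeniusNormSq (fderiv ℝ (u 0) x)) +
          κ * (ν ^ 3)⁻¹ * ∫ t in (0 : ℝ)..b, (∫ x, FluidPDE.frobeniusNormSq (fderiv ℝ (u t) x)) ^ 3) ∧
      (∀ b ∈ Icc 0 T, ENNReal.ofReal ν * ∫⁻ t in Ioo 0 b, ∫⁻ x, ‖(Δ (u t)) x‖ₑ ^ 2 ≤
        ENNReal.ofReal ((∫ x, FluidPDE.frobeniusNormSq (fderiv ℝ (u 0) x)) -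
          (∫ x, FluidPDE.frobeniusNormSq (fderiv ℝ (u b) x)) +
          κ * (ν ^ 3)⁻¹ * ∫ t in (0 : ℝ)..b, (∫ x, FluidPDE.frobeniusNormSq (fderiv ℝ (u t) x)) ^ 3)) ∧
      (∀ t ∈ Icc 0 T, (∫ x, FluidPDE.frobeniusNormSq (fderiv ℝ (u t) x)) ^ 2 ≤
        (∫ x, ‖u t x‖ ^ 2) * ∫ x, ‖(Δ (u t)) x‖ ^ 2) ∧
      (∀ t ∈ Icc 0 T, ∫⁻ x, ‖(Δ (u t)) x‖ₑ ^ 2 = ENNReal.ofReal (∫ x, ‖(Δ (u t)) x‖ ^ 2)) ∧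
      (∀ t ∈ Icc 0 T, ENNReal.ofReal (∫ x, FluidPDE.frobeniusNormSq (fderiv ℝ (u t) x)) =
        ∫⁻ x, ENNReal.ofReal (FluidPDE.frobeniusNormSq (fderiv ℝ (u t) x))) := by
  obtain ⟨C, hC0, hslice⟩ := exists_slice_dissipative
  set K : ℝ≥0 := SNormLESNormFDerivOfEqConst (EuclideanSpace ℝ (Fin 3))
    (volume : Measure (EuclideanSpace ℝ (Fin 3))) 2 with hK
  refine ⟨2 * C * (K : ℝ) ^ 4 + 1, by positivity, ?_⟩
  intro ν T hν hT u p hsol hu hut hp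
  set κ : ℝ := 2 * C * (K : ℝ) ^ 4 + 1 with hκ
  have hκ0 : 0 < κ := by positivity
  have hν3 : 0 < (ν ^ 3)⁻¹ := by positivity
  set e := EuclideanSpace.basisFun (Fin 3) ℝ with he
  have hU : UniqueDiffOn ℝ (Icc 0 T) := uniqueDiffOn_Icc hT
  set W : ℝ → EuclideanSpace ℝ (Fin 3) → EuclideanSpace ℝ (Fin 3) :=
    FluidPDE.timeDerivWithin (Icc 0 T) u with hW
  have hWsm : FluidPDE.IsSmoothSpaceTimeOn (Icc 0 T) W := hsol.smooth_velocity.timeDerivWithin hU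
  -- bounds of the class
  obtain ⟨B₀, hB₀⟩ := linfty_bound_of_hasBoundedSobolevNormsOn_holds
    (fun t ht => (hsol.contDiff_velocity ht).of_le (by norm_cast)) hu
  obtain ⟨C₀, hC₀⟩ := hu 0
  obtain ⟨C₁, hC₁⟩ := hu 1
  obtain ⟨D₂, hD₂⟩ := hu 2
  obtain ⟨D₃, hD₃⟩ := hu 3
  obtain ⟨E₀, hE₀⟩ := hut 0
  obtain ⟨E₁, hE₁⟩ := hut 1
  obtain ⟨P₀, hP₀⟩ := hp 0
  obtain ⟨P₁, hP₁⟩ := hp 1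
  have hzero : ∀ {f : EuclideanSpace ℝ (Fin 3) → EuclideanSpace ℝ (Fin 3)} {C' : ℝ≥0},
      (∫⁻ x, ‖iteratedFDeriv ℝ 0 f x‖ₑ ^ 2 ≤ C') → ∫⁻ x, ‖f x‖ₑ ^ 2 < ⊤ := by
    intro f C' h
    refine lt_of_le_of_lt ((le_of_eq (lintegral_congr fun x => ?_)).trans h) ENNReal.coe_lt_top
    rw [← ofReal_norm, ← ofReal_norm, norm_iteratedFDeriv_zero]
  have hzero' : ∀ {f : EuclideanSpace ℝ (Fin 3) → ℝ} {C' : ℝ≥0},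
      (∫⁻ x, ‖iteratedFDeriv ℝ 0 f x‖ₑ ^ 2 ≤ C') → ∫⁻ x, ‖f x‖ₑ ^ 2 < ⊤ := by
    intro f C' h
    refine lt_of_le_of_lt ((le_of_eq (lintegral_congr fun x => ?_)).trans h) ENNReal.coe_lt_top
    rw [← ofReal_norm, ← ofReal_norm, norm_iteratedFDeriv_zero]
  have hB₀0 : 0 ≤ B₀ := (norm_nonneg _).trans (hB₀ 0 ⟨le_rfl, hT.le⟩ 0)
  have hL2 : ∀ t ∈ Icc 0 T, eLpNorm (u t) 2 volume < ⊤ := fun t ht =>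
    eLpNorm_two_lt_top_of_lintegral_enorm_sq_lt_top (hzero (hC₀ t ht))
  have hL6 : ∀ t ∈ Icc 0 T, eLpNorm (u t) 6 volume < ⊤ := fun t ht =>
    eLpNorm_lt_top_of_bound_of_two hB₀0 (hB₀ t ht) (hzero (hC₀ t ht)) (by norm_num)
  -- the enstrophy balance; the functions `Φ`, `G`, `D` (kept opaque, with defining equations)
  obtain ⟨hΦint, hGcont, hGb⟩ := hsol.smooth_velocity.enstrophy_balance hT hC₁ hE₁
  obtain ⟨Φ, hΦ⟩ : ∃ Φ : ℝ → ℝ,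
      Φ = fun t => ∫ x, 2 * ∑ i, ⟪fderiv ℝ (u t) x (e i), fderiv ℝ (W t) x (e i)⟫ := ⟨_, rfl⟩
  obtain ⟨G, hG⟩ : ∃ G : ℝ → ℝ,
      G = fun t => ∫ x, FluidPDE.frobeniusNormSq (fderiv ℝ (u t) x) := ⟨_, rfl⟩
  obtain ⟨D, hD⟩ : ∃ D : ℝ → ℝ, D = fun t => ∫ x, ‖(Δ (u t)) x‖ ^ 2 := ⟨_, rfl⟩
  have hΦt : ∀ t, Φ t = ∫ x, 2 * ∑ i, ⟪fderiv ℝ (u t) x (e i), fderiv ℝ (W t) x (e i)⟫ :=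
    fun t => by rw [hΦ]
  have hGt : ∀ t, G t = ∫ x, FluidPDE.frobeniusNormSq (fderiv ℝ (u t) x) := fun t => by rw [hG]
  have hDt : ∀ t, D t = ∫ x, ‖(Δ (u t)) x‖ ^ 2 := fun t => by rw [hD]
  rw [← hΦ] at hΦint
  have hGcont0 := hGcont
  rw [← hG] at hGcont
  have hGb' : ∀ b ∈ Ioc 0 T, G b = G 0 + ∫ t in (0 : ℝ)..b, Φ t := by
    intro b hb
    rw [hGt, hGt, hΦ]
    exact hGb b hb
  have hG0 : ∀ t, 0 ≤ G t := fun t => by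
    rw [hGt]; exact integral_nonneg fun x => FluidPDE.frobeniusNormSq_nonneg _
  have hD0 : ∀ t, 0 ≤ D t := fun t => by
    rw [hDt]; exact integral_nonneg fun x => sq_nonneg _
  -- per-slice quantities
  have hDv_eq : ∀ t x, ‖fderiv ℝ (u t) x‖ = ‖iteratedFDeriv ℝ 1 (u t) x‖ := fun t x => by
    rw [← norm_iteratedFDeriv_fderiv, norm_iteratedFDeriv_zero]
  have l2Dv : ∀ t ∈ Icc 0 T, ∫⁻ x, ‖fderiv ℝ (u t) x‖ₑ ^ 2 < ⊤ := fun t ht =>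
    lintegral_enorm_sq_lt_top_of_norm_le (fun x => (hDv_eq t x).le) ((hC₁ t ht).trans_lt ENNReal.coe_lt_top)
  have ifrob : ∀ t ∈ Icc 0 T, Integrable (fun x => FluidPDE.frobeniusNormSq (fderiv ℝ (u t) x)) volume := by
    intro t ht
    have hlt : ∫⁻ x, ENNReal.ofReal (FluidPDE.frobeniusNormSq (fderiv ℝ (u t) x)) < ⊤ :=
      calc ∫⁻ x, ENNReal.ofReal (FluidPDE.frobeniusNormSq (fderiv ℝ (u t) x))
          ≤ ∫⁻ x, 3 * ‖fderiv ℝ (u t) x‖ₑ ^ 2 :=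
            lintegral_mono fun x => ofReal_frobeniusNormSq_le_three_mul_enorm_sq _
        _ = 3 * ∫⁻ x, ‖fderiv ℝ (u t) x‖ₑ ^ 2 := lintegral_const_mul' _ _ (by norm_num)
        _ < ⊤ := ENNReal.mul_lt_top (by norm_num) (l2Dv t ht)
    exact integrable_of_continuous_of_nonneg
      (FluidPDE.continuous_frobeniusNormSq_fderiv (hsol.contDiff_velocity ht) (by simp))
      (fun x => FluidPDE.frobeniusNormSq_nonneg _) hlt
  have iDv : ∀ t ∈ Icc 0 T, Integrable (fun x => ‖fderiv ℝ (u t) x‖ ^ 2) volume := fun t ht =>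
    FluidPDE.integrable_sq_norm_of_lintegral_lt_top
      ((hsol.contDiff_velocity ht).continuous_fderiv (by simp)) (l2Dv t ht)
  have n_Δ : ∀ t ∈ Icc 0 T, ∀ x, ‖(Δ (u t)) x‖ ≤ ‖(3 : ℝ) • iteratedFDeriv ℝ 2 (u t) x‖ := by
    intro t ht x
    rw [norm_smul, Real.norm_of_nonneg (by norm_num : (0 : ℝ) ≤ 3)]
    exact norm_laplacian_le_three_mul_norm_iteratedFDeriv_two
      ((hsol.contDiff_velocity ht).of_le (by norm_cast)) x
  have l2Δ : ∀ t ∈ Icc 0 T, ∫⁻ x, ‖(Δ (u t)) x‖ₑ ^ 2 < ⊤ := fun t ht =>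
    lintegral_enorm_sq_lt_top_of_norm_le (n_Δ t ht)
      (lintegral_enorm_sq_const_smul_lt_top 3 ((hD₂ t ht).trans_lt ENNReal.coe_lt_top))
  have cΔ : ∀ t ∈ Icc 0 T, Continuous (Δ (u t)) := fun t ht =>
    (contDiff_one_laplacian_of_contDiff_three ((hsol.contDiff_velocity ht).of_le (by norm_cast))).continuous
  have iΔΔ : ∀ t ∈ Icc 0 T, Integrable (fun x => ‖(Δ (u t)) x‖ ^ 2) volume := fun t ht =>
    FluidPDE.integrable_sq_norm_of_lintegral_lt_top (cΔ t ht) (l2Δ t ht)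
  -- Sobolev: `‖u(t)‖⁴_{L⁶} ≤ K⁴ G(t)²`
  have hSob : ∀ t ∈ Icc 0 T, (eLpNorm (u t) 6 volume).toReal ^ 4 ≤ (K : ℝ) ^ 4 * G t ^ 2 := by
    intro t ht
    set M : ℝ≥0∞ := eLpNorm (fderiv ℝ (u t)) 2 volume with hM
    have hMtop : M < ⊤ := eLpNorm_two_lt_top_of_lintegral_enorm_sq_lt_top (l2Dv t ht)
    have hS : eLpNorm (u t) 6 volume ≤ K * M :=
      eLpNorm_six_le_eLpNorm_fderiv_two volume finrank_euclideanSpace_fin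
        ((hsol.contDiff_velocity ht).of_le (by norm_cast)) (hL2 t ht)
    have hN : (eLpNorm (u t) 6 volume).toReal ≤ (K : ℝ) * M.toReal := by
      have h := ENNReal.toReal_mono (ENNReal.mul_ne_top ENNReal.coe_ne_top hMtop.ne) hS
      rwa [ENNReal.toReal_mul, ENNReal.coe_toReal] at h
    have hM2 : M.toReal ^ 2 ≤ G t := by
      have h1 : M.toReal ^ 2 = ∫ x, ‖fderiv ℝ (u t) x‖ ^ 2 := by
        rw [← ENNReal.toReal_pow, hM, ← lintegral_enorm_sq_eq_eLpNorm_two_sq,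
          ← ofReal_integral_sq_norm (iDv t ht), ENNReal.toReal_ofReal (integral_nonneg fun _ => sq_nonneg _)]
      rw [h1, hGt]
      exact integral_mono (iDv t ht) (ifrob t ht) fun x => FluidPDE.sq_opNorm_le_frobeniusNormSq _
    have hN0 : 0 ≤ (eLpNorm (u t) 6 volume).toReal := ENNReal.toReal_nonneg
    have hMr0 : 0 ≤ M.toReal := ENNReal.toReal_nonneg
    calc (eLpNorm (u t) 6 volume).toReal ^ 4 ≤ ((K : ℝ) * M.toReal) ^ 4 :=
          pow_le_pow_left₀ hN0 hN 4
      _ = (K : ℝ) ^ 4 * (M.toReal ^ 2) ^ 2 := by ring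
      _ ≤ (K : ℝ) ^ 4 * G t ^ 2 := by
          gcongr
  -- the production bound at each time of the slab
  have hslab : ∀ t ∈ Icc 0 T, Φ t ≤ -ν * D t + κ * (ν ^ 3)⁻¹ * G t ^ 3 := by
    intro t ht
    have hmom : ∀ x, W t x + FluidPDE.convect (u t) (u t) x = ν • (Δ (u t)) x - gradient (p t) x := by
      intro x
      have h := hsol.momentum t ht x
      simpa [hW] using h
    have hsl := hslice hν ((hsol.contDiff_velocity ht).of_le (by norm_cast))
      ((hWsm.contDiff_slice ht).of_le (by norm_cast))
      ((hsol.contDiff_pressure ht).of_le (by norm_cast)) hmom (hsol.divFree t ht)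
      (fun x => hB₀ t ht x) (hL6 t ht)
      ((hC₁ t ht).trans_lt ENNReal.coe_lt_top) ((hD₂ t ht).trans_lt ENNReal.coe_lt_top)
      ((hD₃ t ht).trans_lt ENNReal.coe_lt_top)
      (hzero (hE₀ t ht)) ((hE₁ t ht).trans_lt ENNReal.coe_lt_top)
      (hzero' (hP₀ t ht)) ((hP₁ t ht).trans_lt ENNReal.coe_lt_top)
    have h2 : Φ t = 2 * ∫ x, ∑ i, ⟪fderiv ℝ (u t) x (e i), fderiv ℝ (W t) x (e i)⟫ := by
      rw [hΦt]
      exact integral_const_mul _ _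
    have hN4 := hSob t ht
    have hGnn := hG0 t
    have hprod : C * (ν ^ 3)⁻¹ * (eLpNorm (u t) 6 volume).toReal ^ 4 * G t ≤
        C * (ν ^ 3)⁻¹ * ((K : ℝ) ^ 4 * G t ^ 2) * G t := by
      gcongr
    have hextra : 0 ≤ (ν ^ 3)⁻¹ * G t ^ 3 := mul_nonneg hν3.le (pow_nonneg hGnn 3)
    rw [← hGt t, ← hDt t] at hsl
    rw [h2, hκ]
    nlinarith [hsl, hprod, hextra]
  refine ⟨hGcont0, ?_, ?_, ?_, ?_, fun t ht => ofReal_integral_eq_lintegral_ofReal (ifrob t ht)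
    (Eventually.of_forall fun x => FluidPDE.frobeniusNormSq_nonneg _)⟩
  · -- the cubic inequality `G(b) ≤ G(0) + κ ν⁻³ ∫₀ᵇ G³`
    simp only [← hGt]
    intro b hb
    rcases eq_or_lt_of_le hb.1 with hb0 | hb0
    · rw [← hb0, intervalIntegral.integral_same, mul_zero, add_zero]
    have hΦii : IntervalIntegrable Φ volume 0 b :=
      (intervalIntegrable_iff_integrableOn_Ioo_of_le hb0.le).2
        (hΦint.mono_set (Ioo_subset_Ioo le_rfl hb.2))
    have hgc : ContinuousOn (fun t => κ * (ν ^ 3)⁻¹ * G t ^ 3) (Icc 0 b) :=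
      continuousOn_const.mul ((hGcont.mono (Icc_subset_Icc le_rfl hb.2)).pow 3)
    have hgii : IntervalIntegrable (fun t => κ * (ν ^ 3)⁻¹ * G t ^ 3) volume 0 b :=
      hgc.intervalIntegrable_of_Icc hb0.le
    have hmono : ∫ t in (0 : ℝ)..b, Φ t ≤ ∫ t in (0 : ℝ)..b, κ * (ν ^ 3)⁻¹ * G t ^ 3 := by
      refine intervalIntegral.integral_mono_on hb0.le hΦii hgii fun t ht => ?_
      have h := hslab t ⟨ht.1, ht.2.trans hb.2⟩
      have hνD : 0 ≤ ν * D t := mul_nonneg hν.le (hD0 t)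
      linarith
    rw [hGb' b ⟨hb0, hb.2⟩]
    rw [intervalIntegral.integral_const_mul] at hmono
    linarith
  · -- the dissipation bound on `[0, b]`, keeping `G(0) - G(b)`
    simp only [← hGt]
    intro b hb
    rcases eq_or_lt_of_le hb.1 with hb0 | hb0
    · rw [← hb0, Ioo_self, Measure.restrict_empty, lintegral_zero_measure, mul_zero]
      exact zero_le
    obtain ⟨g, hg⟩ : ∃ g : ℝ → ℝ, g = fun t => κ * (ν ^ 3)⁻¹ * G t ^ 3 - Φ t := ⟨_, rfl⟩
    have hbT : Ioo 0 b ⊆ Icc 0 T := fun t ht => ⟨ht.1.le, ht.2.le.trans hb.2⟩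
    have hpt : ∀ t ∈ Ioo 0 b,
        ENNReal.ofReal ν * ∫⁻ x, ‖(Δ (u t)) x‖ₑ ^ 2 ≤ ENNReal.ofReal (g t) := by
      intro t ht
      have htI : t ∈ Icc 0 T := hbT ht
      rw [← ofReal_integral_sq_norm (iΔΔ t htI), ← ENNReal.ofReal_mul hν.le, ← hDt]
      refine ENNReal.ofReal_le_ofReal ?_
      have h := hslab t htI
      rw [hg]
      linarith
    have hgnn : ∀ t ∈ Ioo 0 b, 0 ≤ g t := fun t ht => by
      have h := hslab t (hbT ht)
      have hνD : 0 ≤ ν * D t := mul_nonneg hν.le (hD0 t)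
      rw [hg]
      linarith
    have hG3int : IntegrableOn (fun t => κ * (ν ^ 3)⁻¹ * G t ^ 3) (Ioo 0 b) volume :=
      ((continuousOn_const.mul ((hGcont.mono (Icc_subset_Icc le_rfl hb.2)).pow 3)).integrableOn_compact
        isCompact_Icc).mono_set Ioo_subset_Icc_self
    have hΦint' : IntegrableOn Φ (Ioo 0 b) volume := hΦint.mono_set (Ioo_subset_Ioo le_rfl hb.2)
    have hgint : IntegrableOn g (Ioo 0 b) volume := by rw [hg]; exact hG3int.sub hΦint'
    have hg_ae : 0 ≤ᵐ[volume.restrict (Ioo 0 b)] g :=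
      (ae_restrict_iff' measurableSet_Ioo).2 (Eventually.of_forall fun t ht => hgnn t ht)
    -- `∫_{(0,b)} Φ = G b - G 0`
    have hΦb : ∫ t in Ioo 0 b, Φ t = G b - G 0 := by
      have h := hGb' b ⟨hb0, hb.2⟩
      rw [intervalIntegral.integral_of_le hb0.le, integral_Ioc_eq_integral_Ioo] at h
      rw [h]
      ring
    have hG3b : ∫ t in Ioo 0 b, κ * (ν ^ 3)⁻¹ * G t ^ 3 =
        κ * (ν ^ 3)⁻¹ * ∫ t in (0 : ℝ)..b, G t ^ 3 := by
      rw [intervalIntegral.integral_of_le hb0.le, integral_Ioc_eq_integral_Ioo, integral_const_mul]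
    have hstep1 : ENNReal.ofReal ν * ∫⁻ t in Ioo 0 b, ∫⁻ x, ‖(Δ (u t)) x‖ₑ ^ 2 ≤
        ∫⁻ t in Ioo 0 b, ENNReal.ofReal (g t) := by
      rw [← lintegral_const_mul' _ _ ENNReal.ofReal_ne_top]
      exact setLIntegral_mono' measurableSet_Ioo hpt
    have hstep2 : ∫⁻ t in Ioo 0 b, ENNReal.ofReal (g t) = ENNReal.ofReal (∫ t in Ioo 0 b, g t) :=
      (ofReal_integral_eq_lintegral_ofReal hgint hg_ae).symm
    have hstep3 : ∫ t in Ioo 0 b, g t = G 0 - G b + κ * (ν ^ 3)⁻¹ * ∫ t in (0 : ℝ)..b, G t ^ 3 := by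
      rw [hg, integral_sub hG3int hΦint', hΦb, hG3b]
      ring
    exact hstep1.trans (hstep2.le.trans (ENNReal.ofReal_le_ofReal hstep3.le))
  · -- interpolation on each slice
    simp only [← hGt]
    intro t ht
    rw [hGt]
    exact sq_integral_frobeniusNormSq_fderiv_le ((hsol.contDiff_velocity ht).of_le (by norm_cast))
      (cΔ t ht) (hzero (hC₀ t ht)) (l2Dv t ht) (l2Δ t ht)
  · -- `∫⁻ ‖Δu(t)‖ₑ² = ofReal ∫ ‖Δu(t)‖²`
    intro t ht
    exact (ofReal_integral_sq_norm (iΔΔ t ht)).symm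

end Slab

/-! ### Leray's small energy–enstrophy monotonicity -/

section Monotone

/-- **Leray's monotonicity of the enstrophy under small energy × enstrophy** (Leray 1934, §20
(3.13)–(3.14) and §34; Robinson–Rodrigo–Sadowski 2016, Lemma 6.13 / proof of Thm. 8.1). There is
an absolute constant `c₀ > 0` such that for every classical solution `(u, p)` of the unforced
Navier–Stokes system on `[0, T] × ℝ³` in the smooth `H¹` class (`u, ∂ₜu, p ∈ L^∞_t H^k_x`), if
`∫ ‖u(t)‖² ≤ E₀` for all `t ∈ [0, T]` and `E₀ · ∫|∇u(0)|² < c₀ ν⁴`, then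
`∫ |∇u(t)|² ≤ ∫ |∇u(0)|²` for every `t ∈ [0, T]`.
Proof: with `G = ∫|∇u|²`, `D = ∫‖Δu‖²`, the combined inequality
`G(b) + ν∫₀ᵇ D ≤ G(0) + κν⁻³∫₀ᵇ G³` (`exists_enstrophy_dissipative_ineq`) and `G² ≤ E₀ D`
(`sq_integral_frobeniusNormSq_fderiv_le` with the energy bound) give
`G(b) ≤ G(0) + ∫₀ᵇ G²(κν⁻³ G − ν/E₀)`, whose integrand is `≤ 0` while `G ≤ ν⁴/(κE₀)`; the
continuity method `le_initial_of_integral_ineq` concludes (`c₀ = κ⁻¹`). [cite: RobinsonRodrigoSadowski2016, Lemma 6.13 and Thm. 8.1 (proof)] -/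
theorem exists_enstrophy_le_initial_of_small :
    ∃ c₀ : ℝ, 0 < c₀ ∧ ∀ ⦃ν T : ℝ⦄ (_ : 0 < ν) (_ : 0 < T)
      ⦃u : ℝ → EuclideanSpace ℝ (Fin 3) → EuclideanSpace ℝ (Fin 3)⦄
      ⦃p : ℝ → EuclideanSpace ℝ (Fin 3) → ℝ⦄
      (_ : FluidPDE.IsClassicalNSSolutionOn (Icc 0 T) ν 0 u p)
      (_ : HasBoundedSobolevNormsOn (Icc 0 T) u)
      (_ : HasBoundedSobolevNormsOn (Icc 0 T) (FluidPDE.timeDerivWithin (Icc 0 T) u))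
      (_ : ∀ n : ℕ, ∃ C : ℝ≥0, ∀ t ∈ Icc 0 T, ∫⁻ x, ‖iteratedFDeriv ℝ n (p t) x‖ₑ ^ 2 ≤ C)
      ⦃E₀ : ℝ⦄ (_ : 0 < E₀) (_ : ∀ t ∈ Icc 0 T, ∫ x, ‖u t x‖ ^ 2 ≤ E₀)
      (_ : E₀ * ∫ x, FluidPDE.frobeniusNormSq (fderiv ℝ (u 0) x) < c₀ * ν ^ 4),
      ∀ t ∈ Icc 0 T, ∫ x, FluidPDE.frobeniusNormSq (fderiv ℝ (u t) x) ≤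
        ∫ x, FluidPDE.frobeniusNormSq (fderiv ℝ (u 0) x) := by
  obtain ⟨κ, hκ, hmain⟩ := exists_enstrophy_dissipative_ineq
  refine ⟨κ⁻¹, by positivity, ?_⟩
  intro ν T hν hT u p hsol hu hut hp E₀ hE₀ hE hsmall
  obtain ⟨hGc, hcub, hdis, hint, hΔeq, -⟩ := hmain hν hT hsol hu hut hp
  obtain ⟨G, hG⟩ : ∃ G : ℝ → ℝ,
      G = fun t => ∫ x, FluidPDE.frobeniusNormSq (fderiv ℝ (u t) x) := ⟨_, rfl⟩
  have hGt : ∀ t, G t = ∫ x, FluidPDE.frobeniusNormSq (fderiv ℝ (u t) x) := fun t => by rw [hG]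
  simp only [← hGt] at hGc hcub hdis hint hsmall ⊢
  have hG0 : ∀ t, 0 ≤ G t := fun t => by
    rw [hGt]; exact integral_nonneg fun x => FluidPDE.frobeniusNormSq_nonneg _
  have hν3 : 0 < (ν ^ 3)⁻¹ := by positivity
  have hν4 : 0 < ν ^ 4 := by positivity
  -- the threshold `θ = ν⁴/(κ E₀)` and the integrand `φ(g) = κ ν⁻³ g³ - (ν/E₀) g²`
  set θ : ℝ := ν ^ 4 / (κ * E₀) with hθdef
  have hκE : 0 < κ * E₀ := mul_pos hκ hE₀
  have hθ : G 0 < θ := by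
    rw [hθdef, lt_div_iff₀ hκE]
    have h : κ * (E₀ * G 0) < κ * (κ⁻¹ * ν ^ 4) := mul_lt_mul_of_pos_left hsmall hκ
    rw [← mul_assoc κ κ⁻¹, mul_inv_cancel₀ hκ.ne', one_mul] at h
    linarith [h, show G 0 * (κ * E₀) = κ * (E₀ * G 0) by ring]
  set φ : ℝ → ℝ := fun g => κ * (ν ^ 3)⁻¹ * g ^ 3 - ν / E₀ * g ^ 2 with hφdef
  have hφc : Continuous φ := by
    simp only [hφdef]; fun_prop
  have hφ : ∀ g, 0 ≤ g → g ≤ θ → φ g ≤ 0 := by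
    intro g hg0 hgθ
    have h1 : κ * (ν ^ 3)⁻¹ * g ≤ ν / E₀ := by
      have h2 : κ * (ν ^ 3)⁻¹ * θ = ν / E₀ := by
        rw [hθdef]
        field_simp
      calc κ * (ν ^ 3)⁻¹ * g ≤ κ * (ν ^ 3)⁻¹ * θ := by gcongr
        _ = ν / E₀ := h2
    have h3 : φ g = g ^ 2 * (κ * (ν ^ 3)⁻¹ * g - ν / E₀) := by simp only [hφdef]; ring
    rw [h3]
    exact mul_nonpos_of_nonneg_of_nonpos (sq_nonneg g) (sub_nonpos.2 h1)
  -- the integrated inequality `G(b) ≤ G(0) + ∫₀ᵇ φ(G)`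
  have hineq : ∀ b ∈ Icc 0 T, G b ≤ G 0 + ∫ t in (0 : ℝ)..b, φ (G t) := by
    intro b hb
    rcases eq_or_lt_of_le hb.1 with hb0 | hb0
    · rw [← hb0, intervalIntegral.integral_same, add_zero]
    have hbT : Ioo 0 b ⊆ Icc 0 T := fun t ht => ⟨ht.1.le, ht.2.le.trans hb.2⟩
    -- pointwise: `ofReal (G t² / E₀) ≤ ∫⁻ ‖Δu(t)‖ₑ²`
    have hpt : ∀ t ∈ Ioo 0 b, ENNReal.ofReal (G t ^ 2 / E₀) ≤ ∫⁻ x, ‖(Δ (u t)) x‖ₑ ^ 2 := by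
      intro t ht
      have htI := hbT ht
      rw [hΔeq t htI]
      refine ENNReal.ofReal_le_ofReal ?_
      rw [div_le_iff₀ hE₀]
      have h1 := hint t htI
      have hD0 : 0 ≤ ∫ x, ‖(Δ (u t)) x‖ ^ 2 := integral_nonneg fun x => sq_nonneg _
      have h2 := mul_le_mul_of_nonneg_right (hE t htI) hD0
      linarith [h1, h2, mul_comm (∫ x, ‖(Δ (u t)) x‖ ^ 2) E₀]
    have hGsq_cont : ContinuousOn (fun t => G t ^ 2 / E₀) (Icc 0 b) :=
      ((hGc.mono (Icc_subset_Icc le_rfl hb.2)).pow 2).div_const _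
    have hGsq_int : IntegrableOn (fun t => G t ^ 2 / E₀) (Ioo 0 b) volume :=
      (hGsq_cont.integrableOn_compact isCompact_Icc).mono_set Ioo_subset_Icc_self
    have hGsq_nn : 0 ≤ᵐ[volume.restrict (Ioo 0 b)] fun t => G t ^ 2 / E₀ :=
      Eventually.of_forall fun t => div_nonneg (sq_nonneg _) hE₀.le
    have hlow : ENNReal.ofReal (ν * ∫ t in Ioo 0 b, G t ^ 2 / E₀) ≤
        ENNReal.ofReal ν * ∫⁻ t in Ioo 0 b, ∫⁻ x, ‖(Δ (u t)) x‖ₑ ^ 2 := by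
      rw [ENNReal.ofReal_mul hν.le, ofReal_integral_eq_lintegral_ofReal hGsq_int hGsq_nn]
      exact mul_le_mul_right (setLIntegral_mono' measurableSet_Ioo hpt) _
    have hchain := hlow.trans (hdis b hb)
    have hrhs0 : 0 ≤ G 0 - G b + κ * (ν ^ 3)⁻¹ * ∫ t in (0 : ℝ)..b, G t ^ 3 := by
      linarith [hcub b hb]
    have hreal : ν * ∫ t in Ioo 0 b, G t ^ 2 / E₀ ≤
        G 0 - G b + κ * (ν ^ 3)⁻¹ * ∫ t in (0 : ℝ)..b, G t ^ 3 :=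
      (ENNReal.ofReal_le_ofReal_iff hrhs0).1 hchain
    -- rewrite everything with interval integrals and assemble `φ`
    have hIoo : ∫ t in Ioo 0 b, G t ^ 2 / E₀ = ∫ t in (0 : ℝ)..b, G t ^ 2 / E₀ := by
      rw [intervalIntegral.integral_of_le hb0.le, integral_Ioc_eq_integral_Ioo]
    rw [hIoo] at hreal
    have hGc' : ContinuousOn G (Icc 0 b) := hGc.mono (Icc_subset_Icc le_rfl hb.2)
    have i3 : IntervalIntegrable (fun t => κ * (ν ^ 3)⁻¹ * G t ^ 3) volume 0 b :=
      (continuousOn_const.mul (hGc'.pow 3)).intervalIntegrable_of_Icc hb0.le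
    have i2 : IntervalIntegrable (fun t => ν / E₀ * G t ^ 2) volume 0 b :=
      (continuousOn_const.mul (hGc'.pow 2)).intervalIntegrable_of_Icc hb0.le
    have hφint : ∫ t in (0 : ℝ)..b, φ (G t) =
        κ * (ν ^ 3)⁻¹ * (∫ t in (0 : ℝ)..b, G t ^ 3) - ν / E₀ * ∫ t in (0 : ℝ)..b, G t ^ 2 := by
      simp only [hφdef]
      rw [intervalIntegral.integral_sub i3 i2, intervalIntegral.integral_const_mul,
        intervalIntegral.integral_const_mul]
    have h2 : ν * ∫ t in (0 : ℝ)..b, G t ^ 2 / E₀ = ν / E₀ * ∫ t in (0 : ℝ)..b, G t ^ 2 := by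
      have : (fun t => G t ^ 2 / E₀) = fun t => E₀⁻¹ * G t ^ 2 := by
        funext t; rw [div_eq_inv_mul]
      rw [this, intervalIntegral.integral_const_mul]
      field_simp
    rw [hφint]
    rw [h2] at hreal
    linarith
  exact le_initial_of_integral_ineq hT.le hGc hφc hφ (fun t _ => hG0 t) hθ hineq

end Monotone

end Literature.Analysis.FluidPDE
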